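import Summits.AtomisticToContinuum.HydrodynamicLimit.Theorems.InformationPercolationEngineChaosClosesEulerShellMeas
import Summits.AtomisticToContinuum.HydrodynamicLimit.Theorems.InformationPercolationEngineChaosClosesEulerShellSlice
import Summits.AtomisticToContinuum.HydrodynamicLimit.Theorems.InformationPercolationEngineChaosClosesEulerShellData
import HarnessLib

/-!
# BF18 shell for functions (crux `ChaosClosesEuler`, stmt-AtomisticToContinuum-15141, line `Sketch`,
# stub `stub_bf18Shell`) — the shell field's slice functions (`stub_bf18ShellField`)

WHAT. The deterministic Březina–Feireisl relative-energy shell of the line compares a measurable bounded shell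
field `V = (ϱ, m, E) : ℝ → 𝕋³ → ℝ × E³ × ℝ` (`ϱ, E ≥ 0`, `|m|² ≤ 2ϱE`, `|ϱ|, |m|, |E| ≤ CV`) with a classical
solution `(ρ, u, θ)` on `[0, T)` of the Euler system for `eos = EulerEOS.monatomicExcess χe f`, through pointwise
integrands `h(s, x)` built from the point data `pdAt T ρ u θ (s, x)` and the shell state
`w(V s x) = (ϱ, E - |m|²/(2ϱ), m)` with the cold/warm selected cut-off: the clamped relative energy `ℰ`, the raw
right-hand side `rawRHS (+ div(p̃ũ))`, the integrands of the hypotheses (H1)–(H3) (`contI`, `momI`, `entI`), and the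
linear pieces of `ℰ`. This file turns them into honest slice functions on `[0, t']`, `t' < T`:

* §1 `slice_pack` (= the registered `stub_bf18ShellField`), `strip_pack`: a function `h` on `ℝ × 𝕋³` whose
  modification off `S = [0, t'] × 𝕋³` by `0` is measurable and which is bounded by `C` on `S` has integrable slices
  `h(s, ·)` with `|∫ₓ h(s, x)| ≤ C` for `s ∈ [0, t']`, `s ↦ ∫ₓ h(s, x)` is integrable on `[0, t']`, and on strips
  `[τ₀, τ₁] × 𝕋³ ⊆ S` Fubini holds with the bound `(τ₁ - τ₀) C`;
* §2 `continuousOn_data`, `measurable_data_restrict`, `exists_fieldBound`: continuity on `S` of the nine components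
  of the point data (measurability on the subtype `S`) and bounds of the classical fields there; affine bounds
  `abs_momI_shell_le`, `abs_contI_shell_le`, `abs_entI_shell_le`, `abs_divPU_le` on admissible shell states;
* §3 `field_relEnergy`, `field_rawRHS`: measurability of the modifications off `S` of `ℰ` and of `rawRHS + div(p̃ũ)`
  and their explicit bounds on `S` in terms of `CV, M, N, B, max |a| |b|` — hence (§1) their slice functions.
  The companion file `…ShellFieldB` treats the remaining integrands and the splitting identities.

WHY. The assembly of `stub_bf18Shell` manipulates `F(s) = ∫ₓ ℰ(s, x)` and the time integrals of the slice
integrals of the pieces (`∫ (f + g) = ∫ f + ∫ g`, monotonicity, Fubini on windows, the windowed Grönwall lemma);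
every such step needs the integrability recorded here.

No named fact is invoked.
-/

noncomputable section

namespace Summit.AtomisticToContinuum.HydrodynamicLimit.Theorems.ChaosClosesEulerShellField

open Set MeasureTheory Function Literature.Analysis.FluidPDE Literature.Analysis.FluidPDE.CompressibleEuler
  Literature.Analysis.FluidPDE.CompressibleEuler.StrongPointData Literature.Analysis.FluidPDE.CompressibleEuler.EulerPhase
  Literature.Analysis.FunctionSpaces
open Summit.AtomisticToContinuum.HydrodynamicLimit.Theorems.ChaosClosesEulerShellMeas
  Summit.AtomisticToContinuum.HydrodynamicLimit.Theorems.ChaosClosesEulerShellSlice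
open Summit.AtomisticToContinuum.HydrodynamicLimit.Theorems.ChaosClosesEulerReduction (continuousOn_uncurry
  exists_window_bound)
open Literature.MathematicalPhysics.KineticTheory (T3 V3 totalEnergyDensity)
open scoped InnerProductSpace

/-! ## §1 Slice functions of bounded functions measurable on `[0, t'] × 𝕋³` -/

section Slices

/-- **Slice pack.** If the modification of `h` off `S = [0, t'] × 𝕋³` by `0` is measurable and `|h| ≤ C` on `S`,
then for `s ∈ [0, t']` the slice `h(s, ·)` is integrable with `|∫ₓ h(s, x)| ≤ C`, and `s ↦ ∫ₓ h(s, x)` is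
integrable on `[0, t']` (the modification has the same slices for `s ∈ [0, t']`; `integrable_integral_slice`).
[folklore] -/
theorem slice_pack (h : ℝ × T3 → ℝ) (t' C : ℝ) (hm : Measurable ((Icc 0 t' ×ˢ univ).piecewise h 0))
    (hb : ∀ z ∈ Icc 0 t' ×ˢ (univ : Set T3), |h z| ≤ C) :
    (∀ s ∈ Icc 0 t', Integrable (fun x => h (s, x)) ∧ |∫ x, h (s, x)| ≤ C) ∧
      IntegrableOn (fun s => ∫ x, h (s, x)) (Icc 0 t') := by
  rcases lt_or_ge t' 0 with ht | ht
  · refine ⟨fun s hs => absurd hs ?_, ?_⟩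
    · rw [Icc_eq_empty_of_lt ht]; exact notMem_empty s
    · rw [Icc_eq_empty_of_lt ht]; exact integrableOn_empty
  have hC0 : 0 ≤ C := (abs_nonneg _).trans (hb ((0 : ℝ), (0 : T3)) ⟨⟨le_rfl, ht⟩, mem_univ _⟩)
  have hgb : ∀ z, |(Icc 0 t' ×ˢ (univ : Set T3)).piecewise h 0 z| ≤ C := fun z => by
    by_cases hz : z ∈ Icc 0 t' ×ˢ (univ : Set T3)
    · rw [piecewise_eq_of_mem _ _ _ hz]; exact hb z hz
    · rw [piecewise_eq_of_notMem _ _ _ hz, Pi.zero_apply, abs_zero]; exact hC0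
  have hslice : ∀ s ∈ Icc (0 : ℝ) t',
      (fun x => (Icc 0 t' ×ˢ (univ : Set T3)).piecewise h 0 (s, x)) = fun x => h (s, x) := fun s hs => by
    funext x
    have hz : (s, x) ∈ Icc 0 t' ×ˢ (univ : Set T3) := ⟨hs, mem_univ x⟩
    exact piecewise_eq_of_mem _ _ _ hz
  obtain ⟨hbd, hint⟩ := integrable_integral_slice hm hgb 0 t'
  refine ⟨fun s hs => ⟨?_, ?_⟩, ?_⟩
  · rw [← hslice s hs]; exact integrable_of_abs_le (hm.comp measurable_prodMk_left) fun x => hgb (s, x)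
  · rw [← hslice s hs]; exact hbd s
  · exact IntegrableOn.congr_fun hint (fun s hs => by simp only [hslice s hs]) measurableSet_Icc

/-- **Strip pack.** Under the hypotheses of `slice_pack`, on every strip `[τ₀, τ₁] × 𝕋³ ⊆ [0, t'] × 𝕋³` the
function `h` is integrable, Fubini holds (`MeasureTheory.setIntegral_prod`), and `|∫∫ h| ≤ (τ₁ - τ₀) C`.
[folklore] -/
theorem strip_pack (h : ℝ × T3 → ℝ) (t' C : ℝ) (hm : Measurable ((Icc 0 t' ×ˢ univ).piecewise h 0))
    (hb : ∀ z ∈ Icc 0 t' ×ˢ (univ : Set T3), |h z| ≤ C) {τ₀ τ₁ : ℝ} (h₀ : 0 ≤ τ₀) (h₀₁ : τ₀ ≤ τ₁)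
    (h₁ : τ₁ ≤ t') :
    IntegrableOn h (Icc τ₀ τ₁ ×ˢ univ) ∧
      (∫ z in Icc τ₀ τ₁ ×ˢ univ, h z) = ∫ s in Icc τ₀ τ₁, ∫ x, h (s, x) ∧
      |∫ z in Icc τ₀ τ₁ ×ˢ univ, h z| ≤ (τ₁ - τ₀) * C := by
  have hsub : Icc τ₀ τ₁ ×ˢ (univ : Set T3) ⊆ Icc 0 t' ×ˢ univ :=
    prod_mono (fun s hs => ⟨h₀.trans hs.1, hs.2.trans h₁⟩) subset_rfl
  have hC0 : 0 ≤ C := (abs_nonneg _).trans (hb ((τ₀ : ℝ), (0 : T3)) (hsub ⟨⟨le_rfl, h₀₁⟩, mem_univ _⟩))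
  have hgb : ∀ z, |(Icc 0 t' ×ˢ (univ : Set T3)).piecewise h 0 z| ≤ C := fun z => by
    by_cases hz : z ∈ Icc 0 t' ×ˢ (univ : Set T3)
    · rw [piecewise_eq_of_mem _ _ _ hz]; exact hb z hz
    · rw [piecewise_eq_of_notMem _ _ _ hz, Pi.zero_apply, abs_zero]; exact hC0
  have hmeas : MeasurableSet (Icc τ₀ τ₁ ×ˢ (univ : Set T3)) := measurableSet_Icc.prod MeasurableSet.univ
  have hint : IntegrableOn h (Icc τ₀ τ₁ ×ˢ univ) :=
    IntegrableOn.congr_fun (integrable_strip_of_abs_le hm hgb τ₀ τ₁) (fun z hz => piecewise_eq_of_mem _ _ _ (hsub hz))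
      hmeas
  refine ⟨hint, ?_, ?_⟩
  · have hint' := hint
    rw [IntegrableOn, Measure.volume_eq_prod] at hint'
    rw [Measure.volume_eq_prod, setIntegral_prod _ hint']
    simp only [Measure.restrict_univ]
  · have hlt : (volume : Measure (ℝ × T3)) (Icc τ₀ τ₁ ×ˢ univ) < ⊤ := by
      rw [volume_strip]; exact ENNReal.ofReal_lt_top
    have key := norm_setIntegral_le_of_norm_le_const hlt (f := h) (C := C) fun z hz => by
      rw [Real.norm_eq_abs]; exact hb z (hsub hz)
    rw [Real.norm_eq_abs, measureReal_def, volume_strip, ENNReal.toReal_ofReal (sub_nonneg.2 h₀₁)] at key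
    linarith

/-- Products with functions continuous on `S`: if `F` restricted to the measurable set `S` is measurable, so is the
modification of `F` off `S` by `0` (restatement of `measurable_piecewise_of_restrict` for the strip). [folklore] -/
theorem measurable_modify_of_restrict {t' : ℝ} {F : ℝ × T3 → ℝ}
    (hF : Measurable ((Icc 0 t' ×ˢ (univ : Set T3)).restrict F)) :
    Measurable ((Icc 0 t' ×ˢ (univ : Set T3)).piecewise F 0) :=
  measurable_piecewise_of_restrict (measurableSet_Icc.prod MeasurableSet.univ) hF

end Slices

/-! ## §2 The classical data on `[0, t'] × 𝕋³` -/

section Data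

variable {eos : EulerEOS} {T t' : ℝ} {ρ θ : ℝ → T3 → ℝ} {u : ℝ → T3 → V3}

/-- **Continuity of the point data on `S = [0, t'] × 𝕋³`, `t' < T`.** The nine components of `pdAt T ρ u θ`
(the fields, their one-sided time derivatives within `[0, T)`, gradients and partial derivatives) are
continuous on `S`, and the density is non-negative there. [folklore] -/
theorem continuousOn_data (hcl : IsClassicalEulerSolution eos T ρ u θ) (ht' : t' < T) :
    ContinuousOn (fun z => (pdAt T ρ u θ z).r) (Icc 0 t' ×ˢ univ) ∧
    ContinuousOn (fun z => (pdAt T ρ u θ z).Θ) (Icc 0 t' ×ˢ univ) ∧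
    ContinuousOn (fun z => (pdAt T ρ u θ z).rt) (Icc 0 t' ×ˢ univ) ∧
    ContinuousOn (fun z => (pdAt T ρ u θ z).Θt) (Icc 0 t' ×ˢ univ) ∧
    ContinuousOn (fun z => (pdAt T ρ u θ z).U) (Icc 0 t' ×ˢ univ) ∧
    ContinuousOn (fun z => (pdAt T ρ u θ z).Ut) (Icc 0 t' ×ˢ univ) ∧
    ContinuousOn (fun z => (pdAt T ρ u θ z).gr) (Icc 0 t' ×ˢ univ) ∧
    ContinuousOn (fun z => (pdAt T ρ u θ z).gΘ) (Icc 0 t' ×ˢ univ) ∧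
    (∀ i j, ContinuousOn (fun z => (pdAt T ρ u θ z).gU i j) (Icc 0 t' ×ˢ univ)) ∧
    ∀ z ∈ Icc 0 t' ×ˢ (univ : Set T3), 0 ≤ (pdAt T ρ u θ z).r := by
  have hsub : Icc 0 t' ×ˢ (univ : Set T3) ⊆ Ico 0 T ×ˢ univ :=
    prod_mono (fun s hs => ⟨hs.1, hs.2.trans_lt ht'⟩) subset_rfl
  have hS := uniqueDiffOn_Ico_time T
  refine ⟨(continuousOn_uncurry hcl.smooth_density).mono hsub,
    (continuousOn_uncurry hcl.smooth_temperature).mono hsub,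
    (continuousOn_uncurry (hcl.smooth_density.timeDerivWithin hS)).mono hsub,
    (continuousOn_uncurry (hcl.smooth_temperature.timeDerivWithin hS)).mono hsub,
    (continuousOn_uncurry hcl.smooth_velocity).mono hsub,
    (continuousOn_uncurry (hcl.smooth_velocity.timeDerivWithin hS)).mono hsub,
    (continuousOn_uncurry (hcl.smooth_density.gradient hS)).mono hsub,
    (continuousOn_uncurry (hcl.smooth_temperature.gradient hS)).mono hsub,
    fun i j => (continuousOn_uncurry ((hcl.smooth_velocity.apply i).partialDeriv hS j)).mono hsub,
    fun z hz => (hcl.density_pos z.1 (hsub hz).1 z.2).le⟩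


/-- The nine components of the point data restricted to the subtype `S = [0, t'] × 𝕋³` are measurable
(continuous on `S`), and the density is non-negative there. [folklore] -/
theorem measurable_data_restrict (hcl : IsClassicalEulerSolution eos T ρ u θ) (ht' : t' < T) :
    Measurable (fun z : ↥(Icc 0 t' ×ˢ (univ : Set T3)) => (pdAt T ρ u θ z).r) ∧
    Measurable (fun z : ↥(Icc 0 t' ×ˢ (univ : Set T3)) => (pdAt T ρ u θ z).Θ) ∧
    Measurable (fun z : ↥(Icc 0 t' ×ˢ (univ : Set T3)) => (pdAt T ρ u θ z).rt) ∧
    Measurable (fun z : ↥(Icc 0 t' ×ˢ (univ : Set T3)) => (pdAt T ρ u θ z).Θt) ∧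
    Measurable (fun z : ↥(Icc 0 t' ×ˢ (univ : Set T3)) => (pdAt T ρ u θ z).U) ∧
    Measurable (fun z : ↥(Icc 0 t' ×ˢ (univ : Set T3)) => (pdAt T ρ u θ z).Ut) ∧
    Measurable (fun z : ↥(Icc 0 t' ×ˢ (univ : Set T3)) => (pdAt T ρ u θ z).gr) ∧
    Measurable (fun z : ↥(Icc 0 t' ×ˢ (univ : Set T3)) => (pdAt T ρ u θ z).gΘ) ∧
    (∀ i j, Measurable (fun z : ↥(Icc 0 t' ×ˢ (univ : Set T3)) => (pdAt T ρ u θ z).gU i j)) ∧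
    ∀ z : ↥(Icc 0 t' ×ˢ (univ : Set T3)), 0 ≤ (pdAt T ρ u θ z).r := by
  obtain ⟨cr, cΘ, crt, cΘt, cU, cUt, cgr, cgΘ, cgU, hr0⟩ := continuousOn_data hcl ht'
  exact ⟨cr.restrict.measurable, cΘ.restrict.measurable, crt.restrict.measurable, cΘt.restrict.measurable,
    cU.restrict.measurable, cUt.restrict.measurable, cgr.restrict.measurable, cgΘ.restrict.measurable,
    fun i j => (cgU i j).restrict.measurable, fun z => hr0 z z.2⟩

/-- **Bounds of the classical fields on `[0, t'] × 𝕋³`, `t' < T`**: one constant `P ≥ 1` with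
`|ρ|, ‖u‖, |θ| ≤ P` there (`exists_window_bound`). [folklore] -/
theorem exists_fieldBound (hcl : IsClassicalEulerSolution eos T ρ u θ) (ht' : t' < T) :
    ∃ P : ℝ, 1 ≤ P ∧ (∀ s ∈ Icc 0 t', ∀ x, |ρ s x| ≤ P) ∧ (∀ s ∈ Icc 0 t', ∀ x, ‖u s x‖ ≤ P) ∧
      ∀ s ∈ Icc 0 t', ∀ x, |θ s x| ≤ P := by
  obtain ⟨P₁, hP₁, h₁, -, -⟩ := exists_window_bound hcl.smooth_density ht'
  obtain ⟨P₂, hP₂, h₂, -, -⟩ := exists_window_bound hcl.smooth_velocity ht'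
  obtain ⟨P₃, hP₃, h₃, -, -⟩ := exists_window_bound hcl.smooth_temperature ht'
  refine ⟨P₁ + P₂ + P₃, by linarith, fun s hs x => ?_, fun s hs x => ?_, fun s hs x => ?_⟩
  · have := h₁ s hs x; rw [Real.norm_eq_abs] at this; linarith
  · have := h₂ s hs x; linarith
  · have := h₃ s hs x; rw [Real.norm_eq_abs] at this; linarith

end Data

/-! ## §2' Two affine bounds -/

section Affine

variable {χe f : ℝ → ℝ} {B M N : ℝ} {d : StrongPointData}

/-- `|momI(w U)| ≤ (9 + 2B) M (ϱ + E)` on admissible shell states, for data bounded by `M` and `|χe| ≤ B` on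
`(0,∞)` (`|m·∂ₜŨ| ≤ 3M(ϱ+E)`, `|(m⊗m/ϱ):∇Ũ| ≤ 6ME`, `|p divŨ| ≤ 2BME`). [folklore] -/
theorem abs_momI_shell_le (f : ℝ → ℝ) (hB : ∀ a, 0 < a → |χe a| ≤ B) (hd : d.Bounded M) (U : ℝ × V3 × ℝ)
    (hρ : 0 ≤ U.1) (hE : 0 ≤ U.2.2) (hm : ‖U.2.1‖ ^ 2 ≤ 2 * U.1 * U.2.2) :
    |d.momI (EulerEOS.monatomicExcess χe f) (U.1, U.2.2 - ‖U.2.1‖ ^ 2 / (2 * U.1), U.2.1)| ≤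
      (9 + 2 * B) * M * (U.1 + U.2.2) := by
  have hM0 : 0 ≤ M := (abs_nonneg _).trans hd.1
  have hB0 : 0 ≤ B := (abs_nonneg _).trans (hB 1 one_pos)
  have h1 := abs_sum_mom_mul_le hd.2.2.2.1 U hρ hE hm
  have h2 := abs_sum_sum_mom_le hd U hρ hE hm
  have h3 : |(EulerEOS.monatomicExcess χe f).p U.1
      (stateTemp (EulerEOS.monatomicExcess χe f) U.1 (U.2.2 - ‖U.2.1‖ ^ 2 / (2 * U.1))) * d.divU| ≤
      2 * B * M * U.2.2 := by
    rw [abs_mul]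
    calc _ ≤ 2 / 3 * B * U.2.2 * (3 * M) :=
          mul_le_mul (abs_pressure_shell_le f hB U hρ hE hm) hd.abs_divU_le (abs_nonneg _) (by positivity)
      _ = 2 * B * M * U.2.2 := by ring
  simp only [momI, dens_mk, mom_mk, ien_mk]
  refine ((abs_add_le _ _).trans (add_le_add ((abs_add_le _ _).trans (add_le_add h1 h2)) h3)).trans ?_
  have hx1 : 6 * M * U.2.2 ≤ 6 * M * (U.1 + U.2.2) := mul_le_mul_of_nonneg_left (by linarith) (by positivity)
  have hx2 : 2 * B * M * U.2.2 ≤ 2 * B * M * (U.1 + U.2.2) :=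
    mul_le_mul_of_nonneg_left (by linarith) (by positivity)
  nlinarith

/-- `|div(p̃ũ)| = |p̃ divŨ + Ũ·∇p̃| ≤ 6MN` for data bounded by `M` with `|p̃|, |∂ⱼp̃| ≤ N`. [folklore] -/
theorem abs_divPU_le (eos : EulerEOS) (hd : d.Bounded M) (hp : |eos.p d.r d.Θ| ≤ N)
    (hgp : ∀ j, |d.gp eos j| ≤ N) : |divPU eos d| ≤ 6 * M * N := by
  have hM0 : 0 ≤ M := (abs_nonneg _).trans hd.1
  have h1 : |eos.p d.r d.Θ * d.divU| ≤ N * (3 * M) := by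
    rw [abs_mul]; exact mul_le_mul hp hd.abs_divU_le (abs_nonneg _) ((abs_nonneg _).trans hp)
  have h2 := abs_sum_mul_le_three hd.2.2.1 hgp
  unfold divPU
  refine ((abs_add_le _ _).trans (add_le_add h1 h2)).trans ?_
  linarith


/-- `|contI(w U)| = |ϱ ∂ₜφ₁ + m·∇φ₁| ≤ 4N(ϱ + E)` on admissible shell states when `|∂ₜφ₁|, |∂ⱼφ₁| ≤ N`. [folklore] -/
theorem abs_contI_shell_le (eos : EulerEOS) (hφ : |d.φ₁t eos| ≤ N) (hgφ : ∀ j, |d.gφ₁ eos j| ≤ N)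
    (U : ℝ × V3 × ℝ) (hρ : 0 ≤ U.1) (hE : 0 ≤ U.2.2) (hm : ‖U.2.1‖ ^ 2 ≤ 2 * U.1 * U.2.2) :
    |d.contI eos (U.1, U.2.2 - ‖U.2.1‖ ^ 2 / (2 * U.1), U.2.1)| ≤ 4 * N * (U.1 + U.2.2) := by
  have hN0 : 0 ≤ N := (abs_nonneg _).trans hφ
  have h1 : |U.1 * d.φ₁t eos| ≤ N * U.1 := by
    rw [abs_mul, abs_of_nonneg hρ, mul_comm]; exact mul_le_mul_of_nonneg_right hφ hρ
  have h2 := abs_sum_mom_mul_le hgφ U hρ hE hm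
  simp only [contI, dens_mk, mom_mk]
  refine ((abs_add_le _ _).trans (add_le_add h1 h2)).trans ?_
  nlinarith

/-- `|entI_Z(w U)| = |ϱ Z(s) ∂ₜΘ̃ + Z(s) m·∇Θ̃| ≤ 4 Zb M (ϱ + E)` on admissible shell states, for data bounded by
`M` and `|Z| ≤ Zb`. [folklore] -/
theorem abs_entI_shell_le (eos : EulerEOS) {Z : ℝ → ℝ} {Zb : ℝ} (hd : d.Bounded M) (hZ : ∀ s, |Z s| ≤ Zb)
    (U : ℝ × V3 × ℝ) (hρ : 0 ≤ U.1) (hE : 0 ≤ U.2.2) (hm : ‖U.2.1‖ ^ 2 ≤ 2 * U.1 * U.2.2) :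
    |d.entI eos Z (U.1, U.2.2 - ‖U.2.1‖ ^ 2 / (2 * U.1), U.2.1)| ≤ 4 * Zb * M * (U.1 + U.2.2) := by
  have hM0 : 0 ≤ M := (abs_nonneg _).trans hd.1
  have hZb0 : 0 ≤ Zb := (abs_nonneg _).trans (hZ 0)
  simp only [entI, dens_mk, mom_mk, ien_mk]
  set ζ := Z (eos.s U.1 (stateTemp eos U.1 (U.2.2 - ‖U.2.1‖ ^ 2 / (2 * U.1)))) with hζ
  have hζb : |ζ| ≤ Zb := hZ _
  have h6 : |U.1 * ζ * d.Θt| ≤ Zb * M * U.1 := by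
    rw [abs_mul, abs_mul, abs_of_nonneg hρ]
    calc U.1 * |ζ| * |d.Θt| ≤ U.1 * Zb * M :=
          mul_le_mul (mul_le_mul_of_nonneg_left hζb hρ) hd.2.1 (abs_nonneg _) (by positivity)
      _ = Zb * M * U.1 := by ring
  have h7 : |∑ i, ζ * U.2.1 i * d.gΘ i| ≤ 3 * (Zb * M) * (U.1 + U.2.2) := by
    have e : ∑ i, ζ * U.2.1 i * d.gΘ i = ∑ i, U.2.1 i * (ζ * d.gΘ i) :=
      Finset.sum_congr rfl fun i _ => by ring
    rw [e]
    refine abs_sum_mom_mul_le (fun i => ?_) U hρ hE hm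
    rw [abs_mul]
    exact mul_le_mul hζb (hd.2.2.2.2.2.1 i) (abs_nonneg _) hZb0
  refine ((abs_add_le _ _).trans (add_le_add h6 h7)).trans ?_
  have : 0 ≤ Zb * M * U.2.2 := by positivity
  nlinarith

end Affine


/-! ## §3 The integrands of the shell: measurability off `S` and bounds on `S` -/

section Field

variable {χe f : ℝ → ℝ} {B T t' CV M N a b : ℝ} {ρ θ : ℝ → T3 → ℝ} {u : ℝ → T3 → V3}
  {V : ℝ → T3 → ℝ × V3 × ℝ}

/-- **(i) The clamped relative energy `ℰ(s, x) = ℰ_{Zsel}(w(V s x) | pdAt (s, x))`.** Its modification off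
`S = [0, t'] × 𝕋³` is measurable (`measurable_modify_pieces_sel` with the data continuous on `S`), and on `S`
`|ℰ| ≤ CV + 6M·CV + CV(N + N max(|a|,|b|)) + N` (`abs_relEnergyZ_shell_le`). [folklore] -/
theorem field_relEnergy (hχc : ContinuousOn χe (Ioi 0)) (hfc : ContinuousOn f (Ioi 0))
    (hcl : IsClassicalEulerSolution (EulerEOS.monatomicExcess χe f) T ρ u θ) (ht' : t' < T)
    (hV : Measurable (uncurry V)) (hV0 : ∀ s x, 0 ≤ (V s x).1) (hVE : ∀ s x, 0 ≤ (V s x).2.2)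
    (hVm : ∀ s x, ‖(V s x).2.1‖ ^ 2 ≤ 2 * (V s x).1 * (V s x).2.2)
    (hCV : ∀ s x, |(V s x).1| ≤ CV ∧ ‖(V s x).2.1‖ ≤ CV ∧ |(V s x).2.2| ≤ CV)
    (hM : ∀ s ∈ Icc 0 t', ∀ x, (pdAt T ρ u θ (s, x)).Bounded M)
    (hN : CoeffBound (EulerEOS.monatomicExcess χe f) T ρ u θ t' N) (hab : a ≤ b) :
    Measurable ((Icc 0 t' ×ˢ (univ : Set T3)).piecewise (fun z =>
      (pdAt T ρ u θ z).relEnergyZ (EulerEOS.monatomicExcess χe f)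
        (if 0 < 2 / 3 * ((V z.1 z.2).2.2 / (V z.1 z.2).1 - ‖(V z.1 z.2).2.1‖ ^ 2 / (2 * (V z.1 z.2).1 ^ 2)) then
          clamp a b else fun _ => a)
        ((V z.1 z.2).1, (V z.1 z.2).2.2 - ‖(V z.1 z.2).2.1‖ ^ 2 / (2 * (V z.1 z.2).1), (V z.1 z.2).2.1)) 0) ∧
    ∀ z ∈ Icc 0 t' ×ˢ (univ : Set T3), |(pdAt T ρ u θ z).relEnergyZ (EulerEOS.monatomicExcess χe f)
        (if 0 < 2 / 3 * ((V z.1 z.2).2.2 / (V z.1 z.2).1 - ‖(V z.1 z.2).2.1‖ ^ 2 / (2 * (V z.1 z.2).1 ^ 2)) then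
          clamp a b else fun _ => a)
        ((V z.1 z.2).1, (V z.1 z.2).2.2 - ‖(V z.1 z.2).2.1‖ ^ 2 / (2 * (V z.1 z.2).1), (V z.1 z.2).2.1)| ≤
      CV + 6 * M * CV + CV * (N + N * max |a| |b|) + N := by
  obtain ⟨cr, cΘ, crt, cΘt, cU, cUt, cgr, cgΘ, cgU, hr0⟩ := continuousOn_data hcl ht'
  have hS : MeasurableSet (Icc (0 : ℝ) t' ×ˢ (univ : Set T3)) := measurableSet_Icc.prod MeasurableSet.univ
  refine ⟨(measurable_modify_pieces_sel (V := fun z => V z.1 z.2) (d := pdAt T ρ u θ) hS hχc hfc hV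
    (fun z => hV0 z.1 z.2) cr cΘ crt cΘt cU cUt cgr cgΘ cgU hr0 a b).1, ?_⟩
  rintro ⟨s, x⟩ ⟨hs, -⟩
  dsimp only
  have hd := hM s hs x
  obtain ⟨hA, hp, hΘ, -⟩ := hN s hs x
  have hM0 : 0 ≤ M := (abs_nonneg _).trans hd.1
  have hN0 : 0 ≤ N := (abs_nonneg _).trans hp
  have hZb0 : 0 ≤ max |a| |b| := le_max_of_le_left (abs_nonneg a)
  obtain ⟨h1, -, h3⟩ := hCV s x
  have hU1 : (V s x).1 ≤ CV := (le_abs_self _).trans h1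
  have hU3 : (V s x).2.2 ≤ CV := (le_abs_self _).trans h3
  have hCV0 : 0 ≤ CV := (hV0 s x).trans hU1
  refine (abs_relEnergyZ_shell_le _ hd (fun σ => abs_cutoffSel_le hab _ σ) _ (hV0 s x) (hVE s x)
    (hVm s x)).trans ?_
  have i1 : ((V s x).1 + (V s x).2.2) * (3 * M) ≤ 2 * CV * (3 * M) :=
    mul_le_mul_of_nonneg_right (by linarith) (by positivity)
  have i2 : (V s x).1 * (|‖(pdAt T ρ u θ (s, x)).U‖ ^ 2 / 2 - (EulerEOS.monatomicExcess χe f).chemPotential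
      (pdAt T ρ u θ (s, x)).r (pdAt T ρ u θ (s, x)).Θ| + |(pdAt T ρ u θ (s, x)).Θ| * max |a| |b|) ≤
      CV * (N + N * max |a| |b|) :=
    mul_le_mul hU1 (add_le_add hA (mul_le_mul_of_nonneg_right hΘ hZb0)) (by positivity) hCV0
  linarith

/-- **(ii) The raw right-hand side plus `div(p̃ũ)`** at the shell state with the selected cut-off: measurable
modification off `S`, and on `S` the bound `N + ((9 + 2B + 4max(|a|,|b|))M + 4N)·2CV + 6MN`
(`abs_rawRHS_shell_le`, `abs_divPU_le`). [folklore] -/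
theorem field_rawRHS (hχc : ContinuousOn χe (Ioi 0)) (hfc : ContinuousOn f (Ioi 0))
    (hB : ∀ a, 0 < a → |χe a| ≤ B)
    (hcl : IsClassicalEulerSolution (EulerEOS.monatomicExcess χe f) T ρ u θ) (ht' : t' < T)
    (hV : Measurable (uncurry V)) (hV0 : ∀ s x, 0 ≤ (V s x).1) (hVE : ∀ s x, 0 ≤ (V s x).2.2)
    (hVm : ∀ s x, ‖(V s x).2.1‖ ^ 2 ≤ 2 * (V s x).1 * (V s x).2.2)
    (hCV : ∀ s x, |(V s x).1| ≤ CV ∧ ‖(V s x).2.1‖ ≤ CV ∧ |(V s x).2.2| ≤ CV)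
    (hM : ∀ s ∈ Icc 0 t', ∀ x, (pdAt T ρ u θ (s, x)).Bounded M)
    (hN : CoeffBound (EulerEOS.monatomicExcess χe f) T ρ u θ t' N) (hab : a ≤ b) :
    Measurable ((Icc 0 t' ×ˢ (univ : Set T3)).piecewise (fun z =>
      rawRHS (EulerEOS.monatomicExcess χe f)
        (if 0 < 2 / 3 * ((V z.1 z.2).2.2 / (V z.1 z.2).1 - ‖(V z.1 z.2).2.1‖ ^ 2 / (2 * (V z.1 z.2).1 ^ 2)) then
          clamp a b else fun _ => a)
        (pdAt T ρ u θ z) (V z.1 z.2).1 ((V z.1 z.2).2.2 - ‖(V z.1 z.2).2.1‖ ^ 2 / (2 * (V z.1 z.2).1)) (V z.1 z.2).2.1 +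
      divPU (EulerEOS.monatomicExcess χe f) (pdAt T ρ u θ z)) 0) ∧
    ∀ z ∈ Icc 0 t' ×ˢ (univ : Set T3), |rawRHS (EulerEOS.monatomicExcess χe f)
        (if 0 < 2 / 3 * ((V z.1 z.2).2.2 / (V z.1 z.2).1 - ‖(V z.1 z.2).2.1‖ ^ 2 / (2 * (V z.1 z.2).1 ^ 2)) then
          clamp a b else fun _ => a)
        (pdAt T ρ u θ z) (V z.1 z.2).1 ((V z.1 z.2).2.2 - ‖(V z.1 z.2).2.1‖ ^ 2 / (2 * (V z.1 z.2).1)) (V z.1 z.2).2.1 +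
      divPU (EulerEOS.monatomicExcess χe f) (pdAt T ρ u θ z)| ≤
      N + ((9 + 2 * B + 4 * max |a| |b|) * M + 4 * N) * (2 * CV) + 6 * M * N := by
  obtain ⟨cr, cΘ, crt, cΘt, cU, cUt, cgr, cgΘ, cgU, hr0⟩ := continuousOn_data hcl ht'
  have hS : MeasurableSet (Icc (0 : ℝ) t' ×ˢ (univ : Set T3)) := measurableSet_Icc.prod MeasurableSet.univ
  refine ⟨(measurable_modify_pieces_sel (V := fun z => V z.1 z.2) (d := pdAt T ρ u θ) hS hχc hfc hV
    (fun z => hV0 z.1 z.2) cr cΘ crt cΘt cU cUt cgr cgΘ cgU hr0 a b).2, ?_⟩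
  rintro ⟨s, x⟩ ⟨hs, -⟩
  dsimp only
  have hd := hM s hs x
  obtain ⟨-, hp, -, hpt, hφ, hgφ, hgp⟩ := hN s hs x
  have hM0 : 0 ≤ M := (abs_nonneg _).trans hd.1
  have hN0 : 0 ≤ N := (abs_nonneg _).trans hp
  have hZb0 : 0 ≤ max |a| |b| := le_max_of_le_left (abs_nonneg a)
  have hB0 : 0 ≤ B := (abs_nonneg _).trans (hB 1 one_pos)
  obtain ⟨h1, -, h3⟩ := hCV s x
  have hU1 : (V s x).1 ≤ CV := (le_abs_self _).trans h1
  have hU3 : (V s x).2.2 ≤ CV := (le_abs_self _).trans h3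
  refine (abs_add_le _ _).trans ((add_le_add (abs_rawRHS_shell_le hB hd (fun σ => abs_cutoffSel_le hab _ σ)
    hφ hgφ hpt _ (hV0 s x) (hVE s x) (hVm s x)) (abs_divPU_le _ hd hp hgp)).trans ?_)
  have : ((9 + 2 * B + 4 * max |a| |b|) * M + 4 * N) * ((V s x).1 + (V s x).2.2) ≤
      ((9 + 2 * B + 4 * max |a| |b|) * M + 4 * N) * (2 * CV) :=
    mul_le_mul_of_nonneg_left (by linarith) (by positivity)
  linarith


end Field

/-! ## The registered sub-goal -/

/-- REGISTERED SUB-GOAL `stub_bf18ShellField` of the line `Sketch` (BF18 shell, the slice functions of the shell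
field): a function `h` on `ℝ × 𝕋³` whose modification off `[0, t'] × 𝕋³` by `0` is measurable and which is bounded by
`C` there has integrable slices with `|∫ₓ h(s, x)| ≤ C` for `s ∈ [0, t']`, and `s ↦ ∫ₓ h(s, x)` is integrable on
`[0, t']` (`slice_pack`). [folklore] -/
theorem stub_bf18ShellField : ∀ (h : ℝ × UnitAddTorus (Fin 3) → ℝ) (t' C : ℝ), Measurable ((Set.Icc 0 t' ×ˢ Set.univ).piecewise h 0) → (∀ z ∈ Set.Icc 0 t' ×ˢ (Set.univ : Set (UnitAddTorus (Fin 3))), |h z| ≤ C) → (∀ s ∈ Set.Icc 0 t', Integrable (fun x => h (s, x)) ∧ |∫ x, h (s, x)| ≤ C) ∧ IntegrableOn (fun s => ∫ x, h (s, x)) (Set.Icc 0 t') :=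
  fun h t' C hm hb => slice_pack h t' C hm hb

end Summit.AtomisticToContinuum.HydrodynamicLimit.Theorems.ChaosClosesEulerShellField

end
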